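import Mathlib
import HarnessLib
import Summits.HubbardSuperconductivity.HubbardSuperconductivity.Theorems.KLProgrammeKLRegimeEnginePairTransferDLineEdgeForward

/-!
# Route `KLProgramme` — ENGINE item stmt-HubbardSuperconductivity-20437 `KLRegimeEngineV17F2`, class-#5 STEP (X).3 budget side, pinned pair «88b» /
# located-risk #14 TAIL: the CROSSED near-form reduction with the WIDE window `G·|Q_m−x−y|_𝕋 ≤ Λ(t)/8` (= the direct window) under `32π/β ≤ Λₙ₊₁`
# (cell gate-hubbard-kl, seat hubbard-kl-k3c2-p2 g22; located «(X).3-TAIL-WINDOW», KL STATUS 2026-08-29 ≈00:32Z)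

WHY.  The crossed tail constant `8192 = 32·16²` of `WDx_edge_row_le_slots` (c = 16) is forced by the crossed forward window `Λₙ₊₁/16`, itself forced by the
near-form reduction `klms_weighted_crossed_eq_near` (`G|Q_m−x−y| ≤ Λ(t)/13` under `16π/β ≤ Λₙ₊₁`: the bosonic shift `2π/β ≤ Λ/8` eats the budget —
`|ω′| < Λ/4 + Λ/8`, `e′² ≥ 7Λ²/64`).  Asking ONE more excluded top scale (`32π/β ≤ Λₙ₊₁`, `2π/β ≤ Λ/16`) gives `|ω′| < 5Λ/16`, `e′² ≥ 39Λ²/256`,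
`|e′| − |e| > (√39/16 − 1/4)Λ ≈ 0.140Λ ≥ Λ/8`: the crossed reduction holds on the DIRECT window `Λ(t)/8`, so the crossed edge rows may take `c = 8`
(`8192 ↦ 2048`, a factor 4 on the crossed tail threshold (T3p): `65709 ↦ ≈16427`, below the direct `32855` — the binding tail becomes the direct one).
* `not_sep_of_close_crossed_wide`, **`crossed_DLine_factors_eq_zero_wide`**, **`klms_weighted_crossed_eq_near_wide`** — text-faithful twins of the `/13` versions
  (…DLineSupport §5, …DLineEdgeForward §1) with `16π/β ↦ 32π/β`, `Λ(t)/13 ↦ Λ(t)/8`, `3Λ/8 ↦ 5Λ/16`, `7/64 ↦ 39/256`.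
Pure support geometry + algebra; nothing about the model's kernel sizes is asserted; nothing asserts (X).3, (c), K3 or superconductivity.
-/

noncomputable section

namespace Summit.HubbardSuperconductivity.HubbardSuperconductivity.Theorems.KLRegimeSplit

set_option linter.dupNamespace false -- summit = problem name (single-conjunct summit), D-0017

open Real Finset Set Literature.MathematicalPhysics.QuantumLattice Literature.Probability.LatticeModels
open Literature.MathematicalPhysics.QuantumLattice.FermiRG
open Summit.HubbardSuperconductivity.HubbardSuperconductivity.Theorems.KLProgrammeLegKernels
open Summit.HubbardSuperconductivity.HubbardSuperconductivity.Theorems.TwoPointAssembly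
open Summit.HubbardSuperconductivity.HubbardSuperconductivity.Theorems.DispersionFlow
open Summit.HubbardSuperconductivity.HubbardSuperconductivity.Theorems.PerturbedFermiCurve
open Summit.HubbardSuperconductivity.HubbardSuperconductivity.Theorems.KLRegimeWick
open Summit.HubbardSuperconductivity.HubbardSuperconductivity.Theorems.EngineV8

variable {L M : ℕ} (β μ : ℝ) (K : TrigPolyC4v)

/-! ## §1 The wide crossed separation and the vanishing of the crossed `D`-row factors -/

/-- The WIDE crossed separation inequality: `|e| < Λ/4`, `|e′ − e| ≤ Λ/8` contradict `39Λ²/256 ≤ e′²` (`(1/4 + 1/8)² = 36/256 < 39/256`). -/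
theorem not_sep_of_close_crossed_wide {Λ e e' : ℝ} (hΛ : 0 < Λ) (he : e ^ 2 < (Λ / 4) ^ 2) (hd : |e' - e| ≤ Λ / 8) (he' : 39 * Λ ^ 2 / 256 ≤ e' ^ 2) :
    False := by
  have h1 : |e| < Λ / 4 := abs_lt.2 ⟨(abs_lt_of_sq_lt_sq' he (by positivity)).1, (abs_lt_of_sq_lt_sq' he (by positivity)).2⟩
  have h2 : |e'| < 3 * Λ / 8 := by
    have := abs_sub_abs_le_abs_sub e' e
    linarith
  have h3 : e' ^ 2 < (3 * Λ / 8) ^ 2 := by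
    have h0 : 0 ≤ |e'| := abs_nonneg _
    have := mul_self_lt_mul_self h0 h2
    rw [← sq_abs e']
    nlinarith
  nlinarith

/-- **The crossed-row factors vanish at small transfer** — WIDE WINDOW (deep pair `n + 2 ≤ j′ ≤ j`, `t ∈ [0,1]`, `32π/β ≤ Λₙ₊₁` i.e. ONE more excluded top scale, crossed frequencies `m′ + 1 = m`, momenta
`k′ = k + (Q_m − x − y)`, `G·|Q_m − x − y|_𝕋 ≤ Λ(t)/8` — the DIRECT window instead of `Λ(t)/13`): `D(p)·ẇ_{Λ(t)}(p′) = 0` and `ẇ_{Λ(t)}(p)·D(p′) = 0`. -/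
theorem crossed_DLine_factors_eq_zero_wide [NeZero L] {R : RenConsts} (hR : ∀ j, 0 ≤ R.Gfr j) {U : ℝ} {N : ℕ} (hK : FrameOK R U N μ K) (hβ : 0 < β) (n : ℕ) (hβn : 32 * π / β ≤ klScale klE0 (n + 1)) {j j' : ℕ} (hj' : n + 2 ≤ j') (hjj : j' ≤ j)
    {t : ℝ} (ht : t ∈ Icc (0 : ℝ) 1) {Qm x y : TorusSite 2 L}
    (hq : (4 + 8 / 3 * R.Gfr 1 * U ^ 2) * klTorusNorm L (Qm - x - y) ≤ (klScale klE0 n + t * (klScale klE0 (n + 1) - klScale klE0 n)) / 8)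
    {p p' : FreqMomentum L M} (hω : matsubaraInt M p'.1 + 1 = matsubaraInt M p.1) (hk : p'.2 = p.2 + Qm - x - y) :
    (softSymbolCompl L M β μ K (n + 1) j p - softSymbolCompl L M β μ K (n + 1) j' p) *
        deriv (fun Λ' : ℝ => hubbardCutoffWeightCT L M β μ K Λ' p') (klScale klE0 n + t * (klScale klE0 (n + 1) - klScale klE0 n)) = 0 ∧
      deriv (fun Λ' : ℝ => hubbardCutoffWeightCT L M β μ K Λ' p) (klScale klE0 n + t * (klScale klE0 (n + 1) - klScale klE0 n)) *
        (softSymbolCompl L M β μ K (n + 1) j p' - softSymbolCompl L M β μ K (n + 1) j' p') = 0 := by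
  set Λ : ℝ := klScale klE0 n + t * (klScale klE0 (n + 1) - klScale klE0 n) with hΛdef
  have hΛ : 0 < Λ := scaleAt_pos n ht
  have hq4 : klScale klE0 j' ≤ Λ / 4 := klScale_le_quarter_scaleAt hj' ht
  have hj'0 := klth_klScale_pos j'
  have hth : 2 * π / β ≤ Λ / 16 := by
    have := (scaleAt_mem n ht).1
    have h32 : 32 * π / β = 16 * (2 * π / β) := by ring
    linarith
  have hth0 : 0 < 2 * π / β := by positivity
  have hfreq : matsubaraFreq β M p'.1 = matsubaraFreq β M p.1 - 2 * π / β := matsubaraFreq_eq_sub_of_matsubaraInt_succ β hω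
  have hk' : p'.2 = p.2 + (Qm - x - y) := by rw [hk]; abel
  have hlip : |nambuXiCT L μ K p'.2 - nambuXiCT L μ K p.2| ≤ Λ / 8 := by
    rw [hk']; exact (abs_nambuXiCT_add_sub_le hR hK p.2 (Qm - x - y)).trans hq
  have hsq : (klScale klE0 j') ^ 2 ≤ (Λ / 4) ^ 2 := pow_le_pow_left₀ hj'0.le hq4 2
  have e4 : (Λ / 4) ^ 2 = Λ ^ 2 / 16 := by ring
  have e516 : (5 * Λ / 16) ^ 2 = 25 * Λ ^ 2 / 256 := by ring
  constructor
  · by_contra hne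
    obtain ⟨hD, hW⟩ := mul_ne_zero_iff.1 hne
    have h1 := radius_lt_of_dLine_ne_zero β μ K n hjj p hD
    obtain ⟨h2, -⟩ := radius_mem_of_slice_ne_zero β μ K hΛ.ne' p' hW
    rw [hfreq] at h2
    -- `|ω_p| < Λ/4`, so `|ω_{p′}| < Λ/4 + Λ/16 = 5Λ/16` and `e′² ≥ Λ²/4 − 25Λ²/256 = 39Λ²/256`
    have hωabs : |matsubaraFreq β M p.1| < Λ / 4 := by
      have hω2 : matsubaraFreq β M p.1 ^ 2 < (Λ / 4) ^ 2 := by linarith [sq_nonneg (nambuXiCT L μ K p.2)]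
      exact abs_lt.2 ⟨(abs_lt_of_sq_lt_sq' hω2 (by positivity)).1, (abs_lt_of_sq_lt_sq' hω2 (by positivity)).2⟩
    have hω'abs : |matsubaraFreq β M p.1 - 2 * π / β| < 5 * Λ / 16 := by
      have := abs_sub (matsubaraFreq β M p.1) (2 * π / β)
      rw [abs_of_pos hth0] at this
      linarith
    have hω'sq : (matsubaraFreq β M p.1 - 2 * π / β) ^ 2 < (5 * Λ / 16) ^ 2 := by
      have h0 : 0 ≤ |matsubaraFreq β M p.1 - 2 * π / β| := abs_nonneg _
      have := mul_self_lt_mul_self h0 hω'abs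
      rw [← sq_abs (matsubaraFreq β M p.1 - 2 * π / β)]
      nlinarith
    have he : nambuXiCT L μ K p.2 ^ 2 < (Λ / 4) ^ 2 := by linarith [sq_nonneg (matsubaraFreq β M p.1)]
    have he' : 39 * Λ ^ 2 / 256 ≤ nambuXiCT L μ K p'.2 ^ 2 := by linarith
    exact not_sep_of_close_crossed_wide hΛ he hlip he'
  · by_contra hne
    obtain ⟨hW, hD⟩ := mul_ne_zero_iff.1 hne
    have h1 := radius_lt_of_dLine_ne_zero β μ K n hjj p' hD
    obtain ⟨h2, -⟩ := radius_mem_of_slice_ne_zero β μ K hΛ.ne' p hW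
    rw [hfreq] at h1
    have hω'abs : |matsubaraFreq β M p.1 - 2 * π / β| < Λ / 4 := by
      have hω2 : (matsubaraFreq β M p.1 - 2 * π / β) ^ 2 < (Λ / 4) ^ 2 := by linarith [sq_nonneg (nambuXiCT L μ K p'.2)]
      exact abs_lt.2 ⟨(abs_lt_of_sq_lt_sq' hω2 (by positivity)).1, (abs_lt_of_sq_lt_sq' hω2 (by positivity)).2⟩
    have hωabs : |matsubaraFreq β M p.1| < 5 * Λ / 16 := by
      have := abs_sub_abs_le_abs_sub (matsubaraFreq β M p.1) (2 * π / β)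
      have e : |matsubaraFreq β M p.1| - |2 * π / β| ≤ |matsubaraFreq β M p.1 - 2 * π / β| := this
      rw [abs_of_pos hth0] at e
      linarith
    have hωsq : matsubaraFreq β M p.1 ^ 2 < (5 * Λ / 16) ^ 2 := by
      have h0 : 0 ≤ |matsubaraFreq β M p.1| := abs_nonneg _
      have := mul_self_lt_mul_self h0 hωabs
      rw [← sq_abs (matsubaraFreq β M p.1)]
      nlinarith
    have he : nambuXiCT L μ K p'.2 ^ 2 < (Λ / 4) ^ 2 := by linarith [sq_nonneg (matsubaraFreq β M p.1 - 2 * π / β)]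
    have he' : 39 * Λ ^ 2 / 256 ≤ nambuXiCT L μ K p.2 ^ 2 := by linarith
    rw [abs_sub_comm] at hlip
    exact not_sep_of_close_crossed_wide hΛ he hlip he'

/-! ## §2 The crossed sum at small transfer (wide window) does not see the deep part of the weight -/

section EqNear

variable [NeZero L] [NeZero M]

open Complex

/-- Two partner weights differing by the deep `D`-line `s_{n+1,j} − s_{n+1,n+2}` (`n+2 ≤ j`) give the same literal CROSSED sum at small transfer
`G|p_{Q_m−x−y}|_𝕋 ≤ Λ(t)/8` (WIDE window; `32π/β ≤ Λₙ₊₁`; every term of the difference has a vanishing line factor, `crossed_DLine_factors_eq_zero_wide`). -/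
theorem klms_weighted_crossed_eq_near_wide {R : RenConsts} (hR : ∀ j, 0 ≤ R.Gfr j) {U : ℝ} {N : ℕ} (hK : FrameOK R U N μ K) (hβ : 0 < β) (n : ℕ)
    (hβn : 32 * π / β ≤ klScale klE0 (n + 1)) {j : ℕ} (hj : n + 2 ≤ j) {t : ℝ} (ht : t ∈ Icc (0 : ℝ) 1) {Qm x y : TorusSite 2 L}
    (hq : (4 + 8 / 3 * R.Gfr 1 * U ^ 2) * klTorusNorm L (Qm - x - y) ≤ (klScale klE0 n + t * (klScale klE0 (n + 1) - klScale klE0 n)) / 8)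
    (w w' : FreqMomentum L M → ℝ)
    (hdiff : ∀ k : FreqMomentum L M, w k = w' k + (softSymbolCompl L M β μ K (n + 1) j k - softSymbolCompl L M β μ K (n + 1) (n + 2) k))
    (Wd : ℝ → FreqMomentum L M → ℝ) (hWd : Wd = fun t k => deriv (fun Λ' : ℝ => hubbardCutoffWeightCT L M β μ K Λ' k) (klScale klE0 n + t * (klScale klE0 (n + 1) - klScale klE0 n)))
    (F : FreqMomentum L M → FreqMomentum L M → ℂ) :
    (∑ p : FreqMomentum L M, ∑ p' : FreqMomentum L M,
        if matsubaraInt M p'.1 + matsubaraInt M (omega0 M) + matsubaraInt M (omega0 M) + 1 = matsubaraInt M p.1 ∧ p'.2 = p.2 + Qm - x - y then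
          ((((((w p) : ℝ) : ℂ) * (((β * (L : ℝ) ^ 2 : ℝ) : ℂ) * propCT L M β μ K p)) * ((((Wd t p') : ℝ) : ℂ) * (((β * (L : ℝ) ^ 2 : ℝ) : ℂ) * propCT L M β μ K p'))) +
              (((((Wd t p) : ℝ) : ℂ) * (((β * (L : ℝ) ^ 2 : ℝ) : ℂ) * propCT L M β μ K p)) * ((((w p') : ℝ) : ℂ) * (((β * (L : ℝ) ^ 2 : ℝ) : ℂ) * propCT L M β μ K p')))) *
            F p p'
        else 0) =
      ∑ p : FreqMomentum L M, ∑ p' : FreqMomentum L M,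
        if matsubaraInt M p'.1 + matsubaraInt M (omega0 M) + matsubaraInt M (omega0 M) + 1 = matsubaraInt M p.1 ∧ p'.2 = p.2 + Qm - x - y then
          ((((((w' p) : ℝ) : ℂ) * (((β * (L : ℝ) ^ 2 : ℝ) : ℂ) * propCT L M β μ K p)) * ((((Wd t p') : ℝ) : ℂ) * (((β * (L : ℝ) ^ 2 : ℝ) : ℂ) * propCT L M β μ K p'))) +
              (((((Wd t p) : ℝ) : ℂ) * (((β * (L : ℝ) ^ 2 : ℝ) : ℂ) * propCT L M β μ K p)) * ((((w' p') : ℝ) : ℂ) * (((β * (L : ℝ) ^ 2 : ℝ) : ℂ) * propCT L M β μ K p')))) *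
            F p p'
        else 0 := by
  rw [← sub_eq_zero, ← Finset.sum_sub_distrib]
  refine Finset.sum_eq_zero fun p _ => ?_
  rw [← Finset.sum_sub_distrib]
  refine Finset.sum_eq_zero fun p' _ => ?_
  split_ifs with hc
  · obtain ⟨hω, hk⟩ := hc
    have hω' : matsubaraInt M p'.1 + 1 = matsubaraInt M p.1 := by simpa [matsubaraInt_omega0] using hω
    obtain ⟨h1, h2⟩ := crossed_DLine_factors_eq_zero_wide β μ K hR hK hβ n hβn le_rfl hj ht hq hω' hk
    have hW : ∀ k : FreqMomentum L M,
        Wd t k = deriv (fun Λ' : ℝ => hubbardCutoffWeightCT L M β μ K Λ' k) (klScale klE0 n + t * (klScale klE0 (n + 1) - klScale klE0 n)) := by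
      intro k; simp only [hWd]
    rw [← hW p'] at h1; rw [← hW p] at h2
    have h1c := congrArg (fun r : ℝ => (r : ℂ)) h1
    have h2c := congrArg (fun r : ℝ => (r : ℂ)) h2
    push_cast at h1c h2c
    rw [sub_eq_zero, hdiff p, hdiff p']
    push_cast
    linear_combination ((β : ℂ) ^ 2 * (L : ℂ) ^ 4 * propCT L M β μ K p * propCT L M β μ K p' * F p p') * h1c +
      ((β : ℂ) ^ 2 * (L : ℂ) ^ 4 * propCT L M β μ K p * propCT L M β μ K p' * F p p') * h2c
  · simp

end EqNear

end Summit.HubbardSuperconductivity.HubbardSuperconductivity.Theorems.KLRegimeSplit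

end
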